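import Literature.Topology.FourManifolds.LatticeForms
import Mathlib.LinearAlgebra.Determinant
import HarnessLib

/-!
# Proofs for integral lattice forms (companion of `LatticeForms.lean`)

Trunk T-4MAN. Discharges of named facts stated in
`Literature/Topology/FourManifolds/LatticeForms.lean` (the statements there are unchanged; a
discharged fact `X` stays a `def X : Prop`, and users holding `(h : X)` are fed `X_holds`):

* `LinearMap.BilinForm.isUnimodular_iff_isUnit_det_holds` — a bilinear form on a lattice is
  unimodular (a perfect pairing, `LinearMap.BilinForm.IsUnimodular`) iff its Gram matrix in a basis
  has unit determinant. Serre, *A Course in Arithmetic*, Ch. V §1.1, (i) ⇔ (ii) (p. 48);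
  Milnor–Husemoller, *Symmetric bilinear forms*, I §2–§3.
* `Literature.Topology.FourManifolds.isUnimodular_e8Form_holds`, `Literature.Topology.FourManifolds.posDef_e8Form_holds`, `Literature.Topology.FourManifolds.signature_e8Form_holds` — the
  `E₈` form (Gram matrix `CartanMatrix.E₈`, which is *verbatim* the matrix of Serre's basis of
  `Γ₈`, Ch. V §1.4.3, p. 51) is unimodular (`d(Γ₈) = 1`), positive definite and of signature
  `τ(Γ₈) = 8` (Serre, Ch. V §1.4.3; Milnor–Husemoller II §6).
* `Literature.Topology.FourManifolds.isUnimodular_hyperbolicForm_holds`, `Literature.Topology.FourManifolds.signature_hyperbolicForm_holds` — the hyperbolic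
  plane `U = !![0, 1; 1, 0]` has `d(U) = -1` and `τ(U) = 0` (Serre, Ch. V §1.4.2, p. 50;
  Milnor–Husemoller I §3, II §2).

Not discharged here: `sigPos_add_sigNeg_eq_finrank` (Sylvester over `ℤ` via base change to
`ℚ`), `eight_dvd_signature_of_isEven` (van der Blij) and `equivalent_of_isIndefinite`
(Serre's classification) — each needs a theory of its own. Note that
`LinearMap.BilinForm.IsUnimodular` (like `IsEven`, `PosDef`, …) is a *definition* (a predicate on
`Q`), not a fact; `not_isUnimodular_zero` records that its universal closure is false.

## Proofs

* Unimodular ⇔ unit determinant: in a basis `b` of `V` and the dual basis of `Dual ℤ V`, the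
  matrix of `x ↦ Q x -` is the transpose of the Gram matrix (`toMatrix_dualBasis_eq_transpose`);
  a linear map between free modules with bases indexed by the same finite type is bijective iff
  its matrix has unit determinant (Mathlib `LinearEquiv.isUnit_det`, `LinearEquiv.ofIsUnitDet`),
  and for a finite free (hence reflexive) module bijectivity of `x ↦ Q x -` already makes `Q` a
  perfect pairing (Mathlib `LinearMap.IsPerfPair.of_bijective`). This is Serre's remark
  "(i) ⇔ (ii), cf. Bourbaki, *Alg.* IX §2 Prop. 3".
* `E₈`: Mathlib records `CartanMatrix.E₈.det = 1` only as `proof_wanted E₈_det`; we exhibit the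
  explicit integral inverse of `E₈` (entries `≤ 30`) and check `E₈ * E₈⁻¹ = 1` by `decide`,
  whence `IsUnit E₈.det`. Positive definiteness is the Lagrange (`LDLᵀ`) reduction of
  `½ E₈(x,x) = ∑ xᵢ² - (x₀x₂ + x₁x₃ + x₂x₃ + x₃x₄ + x₄x₅ + x₅x₆ + x₆x₇)` along the Dynkin chain:
  `840 · ½E₈(x,x) = 210(2x₇-x₆)² + 70(3x₆-2x₅)² + 35(4x₅-3x₄)² + 21(5x₄-4x₃)² + 14(6x₃-5x₁-5x₂)²
  + 10(7x₁-5x₂)² + 210(2x₀-x₂)² + 30x₂²`, a triangular system, so `E₈(x,x) ≤ 0 ⇒ x = 0`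
  (discharged by `linarith`/`omega`). Signature: `b⁺ ≥ 8` from the positive definite submodule
  `⊤`, `b⁺ ≤ rank = 8`, and `b⁻ = 0` since a negative definite submodule of a positive definite
  lattice is `⊥` (Mathlib `sigPos`/`sigNeg` API of `Mathlib.LinearAlgebra.QuadraticForm.Signature`).
* `U`: `det !![0, 1; 1, 0] = -1`; and `(a, b) ↦ (a, -b)` is an isometry `U ≅ -U`
  (built inline), so `b⁻(U) = b⁺(-U) = b⁺(U)` and `τ(U) = 0` without computing
  `b⁺(U) = 1`.

## Sources

* J.-P. Serre, *A Course in Arithmetic* (GTM 7, 1973), Ch. V §1.1 (p. 48), §1.4.2–1.4.3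
  (pp. 50–51). [cite: Serre1973, Ch. V §1]
* J. Milnor, D. Husemoller, *Symmetric bilinear forms* (1973), Ch. I §2–§3, Ch. II §2, §6.
  [cite: MilnorHusemoller1973, I §2–§3; II §2, §6]

## Mathlib

`LinearEquiv.isUnit_det`, `LinearEquiv.ofIsUnitDet` (`Mathlib.LinearAlgebra.Determinant`, the one
extra import), `LinearMap.IsPerfPair.of_bijective`, `Matrix.isUnit_det_of_right_inverse`,
`sigPos_le_finrank`, `le_sigPos_of_posDef`, `exists_finrank_eq_sigNeg_and_negDef`,
`QuadraticMap.Equivalent.sigPos_eq`, `sigPos_neg`. No Mathlib declaration is duplicated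
(`CartanMatrix.E₈_det` is a `proof_wanted`, not a theorem; we prove only `IsUnit E₈.det`).
-/

open Module

namespace LinearMap.BilinForm

variable {V : Type*} [AddCommGroup V] [Module ℤ V] (Q : LinearMap.BilinForm ℤ V)

/-- In a basis `b` of `V` (and the dual basis of `Dual ℤ V`), the matrix of `Q` viewed as the
linear map `x ↦ Q x -` is the transpose of the Gram matrix `BilinForm.toMatrix b Q`
(`(Q (b j)) (b i) = Q (b j) (b i)`); linear-algebra bookkeeping for Serre, *A Course in
Arithmetic* V §1.1. [folklore] -/
theorem toMatrix_dualBasis_eq_transpose {ι : Type*} [Fintype ι] [DecidableEq ι]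
    (b : Basis ι ℤ V) :
    LinearMap.toMatrix b b.dualBasis Q = (BilinForm.toMatrix b Q).transpose := by
  ext i j
  simp [LinearMap.toMatrix_apply, Module.Basis.dualBasis_repr, BilinForm.toMatrix_apply]

/-- **Unimodular ⇔ unit Gram determinant** (discharge of `isUnimodular_iff_isUnit_det`): for a
bilinear form `Q` on a `ℤ`-module with a finite basis `b`, `Q` is a perfect pairing iff
`det (Q (b i) (b j)) = ±1`, i.e. is a unit of `ℤ`. Serre, *A Course in Arithmetic* V §1.1,
(i) ⇔ (ii) (p. 48, referring to Bourbaki, *Alg.* IX §2 Prop. 3); Milnor–Husemoller (1973) I §2–§3.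
[cite: Serre1973, Ch. V §1.1 (i)⇔(ii), p. 48] [cite: MilnorHusemoller1973, I §2–§3] -/
theorem isUnimodular_iff_isUnit_det_holds : Q.isUnimodular_iff_isUnit_det := by
  intro ι _ _ b
  haveI := Module.Finite.of_basis b
  haveI := Module.Free.of_basis b
  have hA := Q.toMatrix_dualBasis_eq_transpose b
  constructor
  · intro h
    have hb : Function.Bijective Q := h.bijective_left
    have hu := LinearEquiv.isUnit_det
      (LinearEquiv.ofBijective (Q : V →ₗ[ℤ] Module.Dual ℤ V) hb) b b.dualBasis
    rwa [show ((LinearEquiv.ofBijective (Q : V →ₗ[ℤ] Module.Dual ℤ V) hb :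
      V →ₗ[ℤ] Module.Dual ℤ V)) = Q from rfl, hA, Matrix.det_transpose] at hu
  · intro h
    rw [← Matrix.det_transpose, ← hA] at h
    have hb : Function.Bijective Q := by
      have := (LinearEquiv.ofIsUnitDet h).bijective
      rwa [← LinearEquiv.coe_coe, LinearEquiv.coe_ofIsUnitDet] at this
    exact LinearMap.IsPerfPair.of_bijective Q hb

/-- `IsUnimodular` is a *predicate* (the definition of unimodularity), not a fact: it fails for
the zero form on `ℤ` (the map `x ↦ 0` to the dual is not injective). Recorded so that no
`IsUnimodular_holds : ∀ Q, Q.IsUnimodular` is ever sought. [folklore] -/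
theorem not_isUnimodular_zero : ¬ (0 : LinearMap.BilinForm ℤ ℤ).IsUnimodular := by
  intro h
  have h01 := h.bijective_left.1 (a₁ := 0) (a₂ := 1) (by simp)
  simp at h01

end LinearMap.BilinForm

namespace Literature.Topology.FourManifolds

open LinearMap.BilinForm

/-! ### The `E₈` form -/

/-- The determinant of the `E₈` Cartan matrix is a unit of `ℤ` (in fact `1`; Mathlib has only
`proof_wanted CartanMatrix.E₈_det`): we exhibit the explicit integral inverse of `E₈` (largest
entry `30`) and check `E₈ * E₈⁻¹ = 1` by `decide`.
Serre, *A Course in Arithmetic* V §1.4.3 (`d(Γ₈) = 1`). [cite: Serre1973, Ch. V §1.4.3, p. 51] -/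
theorem isUnit_det_E₈ : IsUnit CartanMatrix.E₈.det :=
  Matrix.isUnit_det_of_right_inverse
    (B := !![ 4,  5,  7, 10,  8,  6,  4, 2;
              5,  8, 10, 15, 12,  9,  6, 3;
              7, 10, 14, 20, 16, 12,  8, 4;
             10, 15, 20, 30, 24, 18, 12, 6;
              8, 12, 16, 24, 20, 15, 10, 5;
              6,  9, 12, 18, 15, 12,  8, 4;
              4,  6,  8, 12, 10,  8,  6, 3;
              2,  3,  4,  6,  5,  4,  3, 2])
    (by decide)

/-- **The `E₈` form is unimodular** (discharge of `isUnimodular_e8Form`): its Gram matrix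
`CartanMatrix.E₈` — verbatim the matrix of Serre's basis of `Γ₈` — has unit determinant.
Serre, *A Course in Arithmetic* V §1.4.3 (`d(Γ₈) = 1`); Milnor–Husemoller (1973) II §6.
[cite: Serre1973, Ch. V §1.4.3, p. 51] [cite: MilnorHusemoller1973, II §6] -/
theorem isUnimodular_e8Form_holds : isUnimodular_e8Form := by
  rw [isUnimodular_e8Form, isUnimodular_iff_isUnit_det_holds e8Form (Pi.basisFun ℤ (Fin 8)),
    e8Form, LinearMap.BilinForm.toMatrix_basisFun, LinearMap.BilinForm.toMatrix'_toBilin']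
  exact isUnit_det_E₈

/-- The quadratic form of `E₈` in coordinates (Serre's basis of `Γ₈`):
`E₈(x, x) = 2 (∑ xᵢ² - x₀x₂ - x₁x₃ - x₂x₃ - x₃x₄ - x₄x₅ - x₅x₆ - x₆x₇)`.
Serre, *A Course in Arithmetic* V §1.4.3. [cite: Serre1973, Ch. V §1.4.3, p. 51] -/
theorem e8Form_apply_self (x : Fin 8 → ℤ) :
    e8Form x x = 2 * (x 0 ^ 2 + x 1 ^ 2 + x 2 ^ 2 + x 3 ^ 2 + x 4 ^ 2 + x 5 ^ 2 + x 6 ^ 2 + x 7 ^ 2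
      - x 0 * x 2 - x 1 * x 3 - x 2 * x 3 - x 3 * x 4 - x 4 * x 5 - x 5 * x 6 - x 6 * x 7) := by
  simp [e8Form, Matrix.toBilin'_apply', CartanMatrix.E₈, Matrix.mulVec, dotProduct,
    Fin.sum_univ_succ, Matrix.of_apply]
  ring

/-- **The `E₈` form is positive definite** (discharge of `posDef_e8Form`): by Lagrange reduction
along the Dynkin chain, `840 · ½E₈(x,x)` is the positive combination of squares
`210(2x₇-x₆)² + 70(3x₆-2x₅)² + 35(4x₅-3x₄)² + 21(5x₄-4x₃)² + 14(6x₃-5x₁-5x₂)² + 10(7x₁-5x₂)²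
+ 210(2x₀-x₂)² + 30x₂²` of a triangular system of linear forms, so `E₈(x,x) ≤ 0` forces `x = 0`.
Serre, *A Course in Arithmetic* V §1.4.3 (`Γ₈ ⊂ ℚ⁸` with the unit form, `τ(Γ₈) = 8 = r(Γ₈)`);
Milnor–Husemoller (1973) II §6. [cite: Serre1973, Ch. V §1.4.3, pp. 50–51] [cite: MilnorHusemoller1973, II §6] -/
theorem posDef_e8Form_holds : posDef_e8Form := by
  rw [posDef_e8Form, posDef_iff]
  intro x hx
  rw [e8Form_apply_self, ← not_le]
  intro h
  have aux : ∀ t : ℤ, t ^ 2 ≤ 0 → t = 0 := fun t ht =>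
    pow_eq_zero_iff two_ne_zero |>.mp (le_antisymm ht (sq_nonneg t))
  have s7 := sq_nonneg (2 * x 7 - x 6)
  have s6 := sq_nonneg (3 * x 6 - 2 * x 5)
  have s5 := sq_nonneg (4 * x 5 - 3 * x 4)
  have s4 := sq_nonneg (5 * x 4 - 4 * x 3)
  have s3 := sq_nonneg (6 * x 3 - 5 * (x 1 + x 2))
  have s1 := sq_nonneg (7 * x 1 - 5 * x 2)
  have s0 := sq_nonneg (2 * x 0 - x 2)
  have s2 := sq_nonneg (x 2)
  have h2 : x 2 = 0 := aux _ (by linarith)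
  have h0 : 2 * x 0 - x 2 = 0 := aux _ (by linarith)
  have h1 : 7 * x 1 - 5 * x 2 = 0 := aux _ (by linarith)
  have h3 : 6 * x 3 - 5 * (x 1 + x 2) = 0 := aux _ (by linarith)
  have h4 : 5 * x 4 - 4 * x 3 = 0 := aux _ (by linarith)
  have h5 : 4 * x 5 - 3 * x 4 = 0 := aux _ (by linarith)
  have h6 : 3 * x 6 - 2 * x 5 = 0 := aux _ (by linarith)
  have h7 : 2 * x 7 - x 6 = 0 := aux _ (by linarith)
  apply hx
  funext i
  fin_cases i <;> simp <;> omega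

/-- **The `E₈` form has signature `8`** (discharge of `signature_e8Form`): `b⁺ = 8` (the whole
lattice is a positive definite submodule of rank `8 = finrank`) and `b⁻ = 0` (a negative definite
submodule of a positive definite lattice is zero). Serre, *A Course in Arithmetic* V §1.4.3
(`τ(Γ₈) = 8`); Milnor–Husemoller (1973) II §6. [cite: Serre1973, Ch. V §1.4.3, p. 51] [cite: MilnorHusemoller1973, II §6] -/
theorem signature_e8Form_holds : signature_e8Form := by
  have hpos : e8Form.toQuadraticMap.PosDef := posDef_e8Form_holds
  have h1 : sigPos e8Form.toQuadraticMap = 8 := by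
    apply le_antisymm
    · simpa using sigPos_le_finrank e8Form.toQuadraticMap
    · have htop : (e8Form.toQuadraticMap.restrict ⊤).PosDef := fun x hx =>
        hpos x (by simpa using hx)
      simpa [finrank_top] using le_sigPos_of_posDef e8Form.toQuadraticMap htop
  have h2 : sigNeg e8Form.toQuadraticMap = 0 := by
    obtain ⟨W, hW, hneg⟩ := exists_finrank_eq_sigNeg_and_negDef e8Form.toQuadraticMap
    have hbot : W = ⊥ := by
      rw [Submodule.eq_bot_iff]
      intro x hx
      by_contra hx0
      have a := hpos x hx0
      have b := hneg ⟨x, hx⟩ (by simpa using hx0)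
      simp only [QuadraticMap.restrict_apply, QuadraticMap.neg_apply] at b
      linarith
    rw [← hW, hbot, finrank_bot]
  simp [signature_e8Form, signature, h1, h2]

/-! ### The hyperbolic plane -/

/-- **The hyperbolic plane is unimodular** (discharge of `isUnimodular_hyperbolicForm`):
`det !![0, 1; 1, 0] = -1` is a unit. Serre, *A Course in Arithmetic* V §1.4.2 (`d(U) = -1`);
Milnor–Husemoller (1973) I §3. [cite: Serre1973, Ch. V §1.4.2, p. 50] [cite: MilnorHusemoller1973, I §3] -/
theorem isUnimodular_hyperbolicForm_holds : isUnimodular_hyperbolicForm := by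
  rw [isUnimodular_hyperbolicForm,
    isUnimodular_iff_isUnit_det_holds hyperbolicForm (Pi.basisFun ℤ (Fin 2)),
    hyperbolicForm, LinearMap.BilinForm.toMatrix_basisFun, LinearMap.BilinForm.toMatrix'_toBilin',
    Matrix.det_fin_two_of]
  norm_num

/-- **The hyperbolic plane has signature `0`** (discharge of `signature_hyperbolicForm`):
the reflection `(a, b) ↦ (a, -b)` of `ℤ²` is an isometry `U ≅ -U` (quadratic forms `2ab` and
`-2ab`), so `b⁻(U) = b⁺(-U) = b⁺(U)` and `τ(U) = b⁺ - b⁻ = 0`.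
Serre, *A Course in Arithmetic* V §1.4.2 (`τ(U) = 0`); Milnor–Husemoller (1973) II §2.
[cite: Serre1973, Ch. V §1.4.2, p. 50] [cite: MilnorHusemoller1973, II §2] -/
theorem signature_hyperbolicForm_holds : signature_hyperbolicForm := by
  have h : hyperbolicForm.toQuadraticMap.Equivalent (-hyperbolicForm.toQuadraticMap) :=
    ⟨{ toFun := fun x => ![x 0, -x 1]
       invFun := fun x => ![x 0, -x 1]
       map_add' := fun x y => by ext i; fin_cases i <;> simp; ring
       map_smul' := fun c x => by ext i; fin_cases i <;> simp
       left_inv := fun x => by ext i; fin_cases i <;> simp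
       right_inv := fun x => by ext i; fin_cases i <;> simp
       map_app' := fun x => by
         simp [hyperbolicForm, Matrix.toBilin'_apply', Matrix.mulVec, dotProduct,
           Fin.sum_univ_two]
         ring }⟩
  rw [signature_hyperbolicForm, signature, ← sigPos_neg, ← h.sigPos_eq, sub_self]

end Literature.Topology.FourManifolds
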